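import Summits.Ventures.HSemireg.WedgeHankelRecurrenceClasses
import Mathlib.Data.Fintype.BigOperators

/-!
# Venture HSemireg — THE `F_s`-CENSUS OF CLASSES BY MIDDLE RANK: over a finite field with `s` elements and for `2r ≤ N + 1`, **exactly `s^{2r}` of the `s^{N+1}` classes `q` on `[0, N]`
# have middle rank `R^N(q) ≤ r`** — so `(s² − 1)·s^{2r−2}` have `R^N(q) = r ≥ 1`, ONE has `R^N(q) = 0`, of which `(s − 1)·s^{2r−1}` are AFFINE and `(s − 1)·s^{2r−2}` POLAR, and at an even
# level `2t` the remaining `(s − 1)·s^{2t}` classes are the generic ones; by the trapezoid law the same numbers count the `(k+1) × (N+1−k)` Hankel matrices `H^N_k(q)` of every shape by rank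

HONEST FRAMING. Part of the Lean index of the computation cell `pub-hsemireg` (seat p10 gen 28, Sunday typer «UNIFORM-IN-n»).
LINEAR ALGEBRA OF HANKEL (catalecticant) MATRICES and of polynomials over a field ONLY: no variety, no cohomology theory, no sheaf, no Ext group and no semiregularity map is constructed
here; nothing here says that HC / HC_CM / HC_AV holds; no Literature fact is declared or used.  Custodian versions as in `WedgeHankelSiegelIdeal` (1/3); the dictionary (`R^N(q)` the
middle rank; affine ∕ polar classes N43) is QUOTED, never asserted.  READING (classical, not used): the count of Hankel matrices of given rank over a finite field is Daykin's
(J. reine angew. Math. 203 (1960) 47–54); `#{rank H_{m,n}(x) ≤ r} = q^{2r}` is Theorem 1 ∕ Corollary 1 of Dwivedi–Grinberg (Linear Algebra Appl. 2022, arXiv:2109.05415), the square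
case also García-Armas–Ghorpade–Ram (2011); the proof here is different (the transition table of N40 ∕ N42 ∕ N43, level by level).

WHAT IS KEYED / IN THE TREE.  N43 (`WedgeHankelRecurrenceClasses`, p10 g28 claim #1): `IsAffineClass`, `IsPolarClass`, cover ∕ disjoint ∕ congr, `isAffineClass_zero_iff`, `not_isPolarClass_zero`,
the transitions `IsAffineClass.isAffineClass_level_succ_iff`, `IsAffineClass.isPolarClass_level_succ_iff`, `IsAffineClass.of_level_succ`, `IsPolarClass.isPolarClass_level_succ`,
`IsPolarClass.rank_eq_of_level_succ`, `isAffineClass_level_succ_of_top`, `rank_eq_top_of_isAffineClass_level_succ`; N40 (№ 273) `mem_recSpace_succ_iff_hkFun_eq_zero`; N23 (№ 176)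
`recSpace_congr`; N34 (№ 267) `rank_hankel1_half_congr`; N18 (№ 173) `hkFun_eq_sum_range`; N15 `rank_hankel1_eq_min`.  Mathlib: `Fin.snoc` (`snoc_castSucc`, `snoc_last`, `init_snoc`,
`snoc_init_self`), `Finset.card_filter`, `Finset.sum_product`, `Finset.card_eq_sum_card_fiberwise`, `Fintype.card_fun`, `Set.ncard_coe_finset`, `Set.ncard_sdiff_singleton_of_mem`.
THIS FILE (namespace `Summit.Ventures.HSemireg.Wedge.HankelOuter` continued; CHAINED on N43; 1 definition `seqOf`):
* §543 classes on `[0, N]` as coefficient vectors `v : Fin (N+1) → K` (`seqOf K v`; one more coefficient = `Fin.snoc v x`: `seqOf_snoc_of_le`, `seqOf_snoc_last`); counting through the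
  restriction **`ncard_setOf_level_succ_eq_sum`** (`#{w on [0, N+1] | P w} = Σ_v #{x | P (v, x)}`).
* §544 THE DISCREPANCY IS AFFINE IN THE NEW COEFFICIENT: `hkFun_seqOf_snoc`, **`setOf_mem_recSpace_seqOf_snoc`** (exactly ONE `x` continues a full-degree recurrence).
* §545 THE FIBRES over a class `v` on `[0, N]`: affine of rank `r` ⇒ `1` continuation affine of rank `r` and `s − 1` polar of rank `r + 1`; polar of rank `r` ⇒ all `s` polar of rank
  `r + 1`; generic of an even level ⇒ all `s` affine; `0` otherwise (`ncard_setOf_isAffineClass_snoc_of_isAffineClass`, `…_of_not_isAffineClass`, `ncard_setOf_isPolarClass_snoc_of_isAffineClass`,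
  `…_of_isPolarClass`, `…_of_rank_ne`, `ncard_setOf_isAffineClass_snoc_top`, `…_top_of_rank_ne`).
* §546 THE RECURSIONS `A_{N+1}(r) = A_N(r)`, `P_{N+1}(d+1) = (s−1)·A_N(d) + s·P_N(d)`, `A_{2t+1}(t+1) = s·G_{2t}`; the partition `Σ_{r ≤ t+1} T_{2t}(r) = s^{2t+1}`; `T = A + P`; `A_N(0) = 1`,
  `P_N(0) = 0`.  §547 THE CENSUS **`ncard_setOf_isAffineClass_and_isPolarClass`** (induction on the level), **`ncard_setOf_isAffineClass`** (`(s−1)s^{2r−1}`), **`ncard_setOf_isPolarClass`**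
  (`(s−1)s^{2r−2}`), **`ncard_setOf_rank_half_eq`** (`(s²−1)s^{2r−2}`), `ncard_setOf_rank_half_eq_zero`, **`ncard_setOf_rank_half_le`** (`s^{2r}`), **`ncard_setOf_rank_half_eq_top`**
  (`(s−1)s^{2t}`).  §548 EVERY SHAPE (N15): **`ncard_setOf_rank_hankel1_eq`**, **`ncard_setOf_rank_hankel1_eq_height`** (`s^{N+1} − s^{2h−2}` matrices `H^N_k(v)` of full rank `h`).
READING: the numbers do not depend on `N` — a class of rank `r` in the census range is read through a window that sees all of it (N34/N35).  Nothing Ext-side.  New names only.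
-/

open Module Polynomial
open scoped Matrix Polynomial

namespace Summit.Ventures.HSemireg.Wedge.HankelOuter

open Summit.Ventures.HSemireg.Wedge Summit.Ventures.HSemireg.Wedge.Hankel

variable (K : Type*) [Field K] {N : ℕ}

/-! ## §543. Classes on `[0, N]` as coefficient vectors; one more coefficient; counting through the restriction -/

/-- the class on `[0, N]` with coefficient vector `v : Fin (N + 1) → K`, read as a sequence (`0` beyond `N`). [definition of this file] -/
def seqOf (v : Fin (N + 1) → K) : ℕ → K := fun j => if h : j < N + 1 then v ⟨j, h⟩ else 0

/-- `seqOf v j = v_j` for `j ≤ N`. -/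
theorem seqOf_apply_of_lt (v : Fin (N + 1) → K) {j : ℕ} (hj : j < N + 1) : seqOf K v j = v ⟨j, hj⟩ := dif_pos hj

/-- a new coefficient does not change the class on `[0, N]`. -/
theorem seqOf_snoc_of_le (v : Fin (N + 1) → K) (x : K) {j : ℕ} (hj : j ≤ N) : seqOf K (Fin.snoc v x : Fin (N + 1 + 1) → K) j = seqOf K v j := by
  rw [seqOf_apply_of_lt K _ (show j < N + 1 + 1 by omega), seqOf_apply_of_lt K _ (show j < N + 1 by omega)]
  exact Fin.snoc_castSucc (α := fun _ => K) x v ⟨j, by omega⟩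

/-- the new coefficient is `x`. -/
theorem seqOf_snoc_last (v : Fin (N + 1) → K) (x : K) : seqOf K (Fin.snoc v x : Fin (N + 1 + 1) → K) (N + 1) = x := by
  rw [seqOf_apply_of_lt K _ (show N + 1 < N + 1 + 1 by omega)]
  exact Fin.snoc_last (α := fun _ => K) x v

/-- counting a finite set of a finite type by a filter (utility, private). -/
private theorem ncard_setOf_eq_card_filter {α : Type*} [Fintype α] (P : α → Prop) [DecidablePred P] : {a | P a}.ncard = (Finset.univ.filter P).card := by
  rw [← Finset.coe_filter_univ, Set.ncard_coe_finset]

omit [Field K] in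
/-- **COUNTING THROUGH THE RESTRICTION: the classes on `[0, N + 1]` with a property are counted over their restrictions to `[0, N]`, by the number of admissible new coefficients.** -/
theorem ncard_setOf_level_succ_eq_sum [Fintype K] (P : (Fin (N + 1 + 1) → K) → Prop) :
    {w | P w}.ncard = ∑ v : Fin (N + 1) → K, {x : K | P (Fin.snoc v x)}.ncard := by
  classical
  let e : (Fin (N + 1) → K) × K ≃ (Fin (N + 1 + 1) → K) :=
    { toFun := fun p => Fin.snoc p.1 p.2
      invFun := fun w => (Fin.init w, w (Fin.last _))
      left_inv := fun p => by obtain ⟨v, x⟩ := p; simp only [Fin.init_snoc, Fin.snoc_last]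
      right_inv := fun w => Fin.snoc_init_self w }
  have h1 : Finset.univ.filter P = ((Finset.univ : Finset ((Fin (N + 1) → K) × K)).map e.toEmbedding).filter P := by rw [Finset.map_univ_equiv]
  rw [ncard_setOf_eq_card_filter, h1, Finset.filter_map, Finset.card_map, ← Finset.univ_product_univ, Finset.card_filter, Finset.sum_product]
  refine Finset.sum_congr rfl fun v _ => ?_
  rw [ncard_setOf_eq_card_filter, Finset.card_filter]
  rfl

/-! ## §544. The discrepancy of a full-degree recurrence is affine in the new coefficient: exactly one continuation -/

/-- **reading the new coefficient: for `deg m = d ≤ N + 1`, `⟪m, (v, x)⟫_{N+1−d} = Σ_{i<d} m_i v_{i+N+1−d} + lc(m) · x`.** -/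
theorem hkFun_seqOf_snoc (v : Fin (N + 1) → K) (x : K) {m : K[X]} {d : ℕ} (hmd : m.natDegree = d) (hd : d ≤ N + 1) :
    hkFun K (seqOf K (Fin.snoc v x : Fin (N + 1 + 1) → K)) (N + 1 - d) m
      = (∑ i ∈ Finset.range d, m.coeff i * seqOf K v (i + (N + 1 - d))) + m.leadingCoeff * x := by
  rw [hkFun_eq_sum_range K _ _ (show m.natDegree < d + 1 by omega), Finset.sum_range_succ]
  congr 1
  · exact Finset.sum_congr rfl fun i hi => by rw [seqOf_snoc_of_le K v x (by have := Finset.mem_range.mp hi; omega)]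
  · rw [show d + (N + 1 - d) = N + 1 by omega, seqOf_snoc_last, Polynomial.leadingCoeff, hmd]

/-- **EXACTLY ONE VALUE OF THE NEW COEFFICIENT CONTINUES A FULL-DEGREE RECURRENCE: for `0 ≠ m ∈ Rec^N_d(v)` of degree `d ≤ N + 1`,
`{x | m ∈ Rec^{N+1}_d(v, x)} = {−(Σ_{i<d} m_i v_{i+N+1−d}) / lc(m)}`** (N40's one new condition, solved for `x`). -/
theorem setOf_mem_recSpace_seqOf_snoc (v : Fin (N + 1) → K) {m : K[X]} {d : ℕ} (hm0 : m ≠ 0) (hmd : m.natDegree = d) (hd : d ≤ N + 1)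
    (hm : m ∈ recSpace K N (seqOf K v) d) :
    {x : K | m ∈ recSpace K (N + 1) (seqOf K (Fin.snoc v x : Fin (N + 1 + 1) → K)) d}
      = {-(∑ i ∈ Finset.range d, m.coeff i * seqOf K v (i + (N + 1 - d))) / m.leadingCoeff} := by
  have hlc : m.leadingCoeff ≠ 0 := Polynomial.leadingCoeff_ne_zero.mpr hm0
  ext x
  rw [Set.mem_setOf_eq, Set.mem_singleton_iff]
  have hmN : m ∈ recSpace K N (seqOf K (Fin.snoc v x : Fin (N + 1 + 1) → K)) d := by
    rwa [recSpace_congr K (fun j hj => seqOf_snoc_of_le K v x hj)]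
  rw [mem_recSpace_succ_iff_hkFun_eq_zero K hd hmN, hkFun_seqOf_snoc K v x hmd hd]
  exact ⟨fun h => by rw [eq_div_iff hlc]; linear_combination h, fun h => by rw [h, mul_div_cancel₀ _ hlc, add_neg_cancel]⟩

/-! ## §545. The fibres of the census: `1 ∕ 0`, `s − 1 ∕ s ∕ 0`, `s ∕ 0` admissible new coefficients -/

/-- **over an AFFINE class of rank `r` (`2r ≤ N + 1`) exactly ONE continuation is affine of rank `r`.** -/
theorem ncard_setOf_isAffineClass_snoc_of_isAffineClass {r : ℕ} (v : Fin (N + 1) → K) (h2 : r + r ≤ N + 1) (hA : IsAffineClass K N r (seqOf K v)) :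
    {x : K | IsAffineClass K (N + 1) r (seqOf K (Fin.snoc v x : Fin (N + 1 + 1) → K))}.ncard = 1 := by
  obtain ⟨-, m, hm, hm0, hmd⟩ := id hA
  have key : {x : K | IsAffineClass K (N + 1) r (seqOf K (Fin.snoc v x : Fin (N + 1 + 1) → K))}
      = {x : K | m ∈ recSpace K (N + 1) (seqOf K (Fin.snoc v x : Fin (N + 1 + 1) → K)) r} := by
    ext x
    have hAx : IsAffineClass K N r (seqOf K (Fin.snoc v x : Fin (N + 1 + 1) → K)) := (isAffineClass_congr K fun j hj => seqOf_snoc_of_le K v x hj).mpr hA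
    have hmx : m ∈ recSpace K N (seqOf K (Fin.snoc v x : Fin (N + 1 + 1) → K)) r := by rwa [recSpace_congr K fun j hj => seqOf_snoc_of_le K v x hj]
    exact hAx.isAffineClass_level_succ_iff h2 hmx hm0 hmd
  rw [key, setOf_mem_recSpace_seqOf_snoc K v hm0 hmd (by omega) hm, Set.ncard_singleton]

/-- … and over any other class NONE is. -/
theorem ncard_setOf_isAffineClass_snoc_of_not_isAffineClass {r : ℕ} (v : Fin (N + 1) → K) (h2 : r + r ≤ N + 1) (hA : ¬ IsAffineClass K N r (seqOf K v)) :
    {x : K | IsAffineClass K (N + 1) r (seqOf K (Fin.snoc v x : Fin (N + 1 + 1) → K))}.ncard = 0 := by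
  have he : {x : K | IsAffineClass K (N + 1) r (seqOf K (Fin.snoc v x : Fin (N + 1 + 1) → K))} = ∅ :=
    Set.eq_empty_iff_forall_notMem.mpr fun x hx => hA ((isAffineClass_congr K fun j hj => seqOf_snoc_of_le K v x hj).mp (IsAffineClass.of_level_succ hx h2))
  rw [he, Set.ncard_empty]

/-- **over an AFFINE class of rank `d` (`2d ≤ N`) exactly `s − 1` continuations are polar of rank `d + 1`** (all but the continuing one). -/
theorem ncard_setOf_isPolarClass_snoc_of_isAffineClass [Finite K] {d : ℕ} (v : Fin (N + 1) → K) (h2 : d + d ≤ N) (hA : IsAffineClass K N d (seqOf K v)) :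
    {x : K | IsPolarClass K (N + 1) (d + 1) (seqOf K (Fin.snoc v x : Fin (N + 1 + 1) → K))}.ncard = Nat.card K - 1 := by
  obtain ⟨-, m, hm, hm0, hmd⟩ := id hA
  set x₀ : K := -(∑ i ∈ Finset.range d, m.coeff i * seqOf K v (i + (N + 1 - d))) / m.leadingCoeff
  have key : {x : K | IsPolarClass K (N + 1) (d + 1) (seqOf K (Fin.snoc v x : Fin (N + 1 + 1) → K))} = Set.univ \ {x₀} := by
    rw [← setOf_mem_recSpace_seqOf_snoc K v hm0 hmd (by omega) hm]
    ext x
    have hAx : IsAffineClass K N d (seqOf K (Fin.snoc v x : Fin (N + 1 + 1) → K)) := (isAffineClass_congr K fun j hj => seqOf_snoc_of_le K v x hj).mpr hA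
    have hmx : m ∈ recSpace K N (seqOf K (Fin.snoc v x : Fin (N + 1 + 1) → K)) d := by rwa [recSpace_congr K fun j hj => seqOf_snoc_of_le K v x hj]
    rw [Set.mem_sdiff, Set.mem_setOf_eq, Set.mem_setOf_eq, hAx.isPolarClass_level_succ_iff h2 hmx hm0 hmd]
    exact ⟨fun h => ⟨Set.mem_univ x, h⟩, fun h => h.2⟩
  rw [key, Set.ncard_sdiff_singleton_of_mem (Set.mem_univ x₀), Set.ncard_univ]

/-- **over a POLAR class of rank `d` (`2d ≤ N`) ALL `s` continuations are polar of rank `d + 1`.** -/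
theorem ncard_setOf_isPolarClass_snoc_of_isPolarClass [Finite K] {d : ℕ} (v : Fin (N + 1) → K) (h2 : d + d ≤ N) (hP : IsPolarClass K N d (seqOf K v)) :
    {x : K | IsPolarClass K (N + 1) (d + 1) (seqOf K (Fin.snoc v x : Fin (N + 1 + 1) → K))}.ncard = Nat.card K := by
  rw [← Set.ncard_univ K]
  exact congrArg Set.ncard (Set.eq_univ_of_forall fun x => ((isPolarClass_congr K fun j hj => seqOf_snoc_of_le K v x hj).mpr hP).isPolarClass_level_succ h2)

/-- … and over a class of rank `≠ d` NO continuation is polar of rank `d + 1` (`2d ≤ N`). -/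
theorem ncard_setOf_isPolarClass_snoc_of_rank_ne {d : ℕ} (v : Fin (N + 1) → K) (h2 : d + d ≤ N) (hq : (hankel1 K N (N / 2) (seqOf K v)).rank ≠ d) :
    {x : K | IsPolarClass K (N + 1) (d + 1) (seqOf K (Fin.snoc v x : Fin (N + 1 + 1) → K))}.ncard = 0 := by
  have he : {x : K | IsPolarClass K (N + 1) (d + 1) (seqOf K (Fin.snoc v x : Fin (N + 1 + 1) → K))} = ∅ := Set.eq_empty_iff_forall_notMem.mpr fun x hx =>
    hq (by rw [← rank_hankel1_half_congr K fun j hj => seqOf_snoc_of_le K v x hj]; exact IsPolarClass.rank_eq_of_level_succ hx h2)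
  rw [he, Set.ncard_empty]

/-- **over a GENERIC class of the even level `2t` ALL `s` continuations are affine of rank `t + 1`.** -/
theorem ncard_setOf_isAffineClass_snoc_top [Finite K] {t : ℕ} (v : Fin (2 * t + 1) → K) (hq : (hankel1 K (2 * t) (2 * t / 2) (seqOf K v)).rank = t + 1) :
    {x : K | IsAffineClass K (2 * t + 1) (t + 1) (seqOf K (Fin.snoc v x : Fin (2 * t + 1 + 1) → K))}.ncard = Nat.card K := by
  rw [← Set.ncard_univ K]
  exact congrArg Set.ncard (Set.eq_univ_of_forall fun x => isAffineClass_level_succ_of_top K (by rwa [rank_hankel1_half_congr K fun j hj => seqOf_snoc_of_le K v x hj]))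

/-- … and over a non-generic class of the even level NONE is. -/
theorem ncard_setOf_isAffineClass_snoc_top_of_rank_ne {t : ℕ} (v : Fin (2 * t + 1) → K) (hq : (hankel1 K (2 * t) (2 * t / 2) (seqOf K v)).rank ≠ t + 1) :
    {x : K | IsAffineClass K (2 * t + 1) (t + 1) (seqOf K (Fin.snoc v x : Fin (2 * t + 1 + 1) → K))}.ncard = 0 := by
  have he : {x : K | IsAffineClass K (2 * t + 1) (t + 1) (seqOf K (Fin.snoc v x : Fin (2 * t + 1 + 1) → K))} = ∅ := Set.eq_empty_iff_forall_notMem.mpr fun x hx =>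
    hq (by rw [← rank_hankel1_half_congr K fun j hj => seqOf_snoc_of_le K v x hj]; exact rank_eq_top_of_isAffineClass_level_succ hx)
  rw [he, Set.ncard_empty]

/-! ## §546. The recursions of the census -/
/-- **`A_{N+1}(r) = A_N(r)`** (`2r ≤ N + 1`): the affine classes of rank `r` one level up sit over the affine classes of rank `r`, one each. -/
theorem ncard_setOf_isAffineClass_level_succ [Finite K] {r : ℕ} (h2 : r + r ≤ N + 1) :
    {w : Fin (N + 1 + 1) → K | IsAffineClass K (N + 1) r (seqOf K w)}.ncard = {v : Fin (N + 1) → K | IsAffineClass K N r (seqOf K v)}.ncard := by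
  classical
  haveI := Fintype.ofFinite K
  rw [ncard_setOf_level_succ_eq_sum, ncard_setOf_eq_card_filter, Finset.card_filter]
  refine Finset.sum_congr rfl fun v _ => ?_
  split_ifs with hA
  · exact ncard_setOf_isAffineClass_snoc_of_isAffineClass K v h2 hA
  · exact ncard_setOf_isAffineClass_snoc_of_not_isAffineClass K v h2 hA

/-- **`P_{N+1}(d+1) = (s − 1)·A_N(d) + s·P_N(d)`** (`2d ≤ N`). -/
theorem ncard_setOf_isPolarClass_level_succ [Finite K] {d : ℕ} (h2 : d + d ≤ N) :
    {w : Fin (N + 1 + 1) → K | IsPolarClass K (N + 1) (d + 1) (seqOf K w)}.ncard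
      = (Nat.card K - 1) * {v : Fin (N + 1) → K | IsAffineClass K N d (seqOf K v)}.ncard
        + Nat.card K * {v : Fin (N + 1) → K | IsPolarClass K N d (seqOf K v)}.ncard := by
  classical
  haveI := Fintype.ofFinite K
  rw [ncard_setOf_level_succ_eq_sum, ncard_setOf_eq_card_filter, ncard_setOf_eq_card_filter, Finset.card_filter, Finset.card_filter, Finset.mul_sum, Finset.mul_sum,
    ← Finset.sum_add_distrib]
  refine Finset.sum_congr rfl fun v _ => ?_
  by_cases hA : IsAffineClass K N d (seqOf K v)
  · rw [if_pos hA, if_neg hA.not_isPolarClass, ncard_setOf_isPolarClass_snoc_of_isAffineClass K v h2 hA]; ring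
  · by_cases hP : IsPolarClass K N d (seqOf K v)
    · rw [if_neg hA, if_pos hP, ncard_setOf_isPolarClass_snoc_of_isPolarClass K v h2 hP]; ring
    · have hq : (hankel1 K N (N / 2) (seqOf K v)).rank ≠ d := fun h => (isAffineClass_or_isPolarClass K h).elim hA hP
      rw [if_neg hA, if_neg hP, ncard_setOf_isPolarClass_snoc_of_rank_ne K v h2 hq]; ring

/-- **`A_{2t+1}(t+1) = s · G_{2t}`**, `G_{2t}` the number of generic classes (`R^{2t} = t + 1`) of the even level. -/
theorem ncard_setOf_isAffineClass_top_level_succ [Finite K] (t : ℕ) :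
    {w : Fin (2 * t + 1 + 1) → K | IsAffineClass K (2 * t + 1) (t + 1) (seqOf K w)}.ncard
      = Nat.card K * {v : Fin (2 * t + 1) → K | (hankel1 K (2 * t) (2 * t / 2) (seqOf K v)).rank = t + 1}.ncard := by
  classical
  haveI := Fintype.ofFinite K
  rw [ncard_setOf_level_succ_eq_sum, ncard_setOf_eq_card_filter, Finset.card_filter, Finset.mul_sum]
  refine Finset.sum_congr rfl fun v _ => ?_
  split_ifs with hq
  · rw [ncard_setOf_isAffineClass_snoc_top K v hq, mul_one]
  · rw [ncard_setOf_isAffineClass_snoc_top_of_rank_ne K v hq, mul_zero]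

/-- **the partition of an even level by middle rank: `Σ_{r ≤ t+1} #{v on [0, 2t] | R^{2t}(v) = r} = s^{2t+1}`.** -/
theorem sum_ncard_setOf_rank_half_eq [Finite K] (t : ℕ) :
    ∑ r ∈ Finset.range (t + 2), {v : Fin (2 * t + 1) → K | (hankel1 K (2 * t) (2 * t / 2) (seqOf K v)).rank = r}.ncard = Nat.card K ^ (2 * t + 1) := by
  classical
  haveI := Fintype.ofFinite K
  have hmaps : ((Finset.univ : Finset (Fin (2 * t + 1) → K)) : Set (Fin (2 * t + 1) → K)).MapsTo
      (fun v => (hankel1 K (2 * t) (2 * t / 2) (seqOf K v)).rank) (Finset.range (t + 2) : Finset ℕ) := fun v _ => by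
    have h : (hankel1 K (2 * t) (2 * t / 2) (seqOf K v)).rank ≤ 2 * t / 2 + 1 := Matrix.rank_le_height _
    exact Finset.mem_coe.mpr (Finset.mem_range.mpr (show (hankel1 K (2 * t) (2 * t / 2) (seqOf K v)).rank < t + 2 by omega))
  have h := Finset.card_eq_sum_card_fiberwise hmaps
  rw [Finset.card_univ, Fintype.card_fun, Fintype.card_fin, ← Nat.card_eq_fintype_card] at h
  exact h ▸ Finset.sum_congr rfl fun r _ => ncard_setOf_eq_card_filter _

/-- **`T_N(r) = A_N(r) + P_N(r)`**: the classes of rank `r` are the affine plus the polar ones. -/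
theorem ncard_setOf_rank_half_eq_add [Finite K] (N r : ℕ) :
    {v : Fin (N + 1) → K | (hankel1 K N (N / 2) (seqOf K v)).rank = r}.ncard
      = {v : Fin (N + 1) → K | IsAffineClass K N r (seqOf K v)}.ncard + {v : Fin (N + 1) → K | IsPolarClass K N r (seqOf K v)}.ncard := by
  have hunion : {v : Fin (N + 1) → K | (hankel1 K N (N / 2) (seqOf K v)).rank = r}
      = {v : Fin (N + 1) → K | IsAffineClass K N r (seqOf K v)} ∪ {v : Fin (N + 1) → K | IsPolarClass K N r (seqOf K v)} := by
    ext v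
    rw [Set.mem_setOf_eq, Set.mem_union, Set.mem_setOf_eq, Set.mem_setOf_eq]
    exact ⟨fun h => isAffineClass_or_isPolarClass K h, fun h => h.elim (fun h => h.rank_eq) fun h => h.rank_eq⟩
  have hdisj : Disjoint {v : Fin (N + 1) → K | IsAffineClass K N r (seqOf K v)} {v : Fin (N + 1) → K | IsPolarClass K N r (seqOf K v)} :=
    Set.disjoint_left.mpr fun v hA hP => IsAffineClass.not_isPolarClass hA hP
  rw [hunion, Set.ncard_union_eq hdisj (Set.toFinite _) (Set.toFinite _)]

/-- **`A_N(0) = 1`**: the only affine class of rank `0` is the zero class. -/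
theorem ncard_setOf_isAffineClass_zero (N : ℕ) : {v : Fin (N + 1) → K | IsAffineClass K N 0 (seqOf K v)}.ncard = 1 := by
  rw [Set.ncard_eq_one]
  refine ⟨0, Set.eq_singleton_iff_unique_mem.mpr ⟨(isAffineClass_zero_iff K _).mpr fun j hj => ?_, fun v hv => funext fun i => ?_⟩⟩
  · rw [seqOf_apply_of_lt K _ (show j < N + 1 by omega)]; rfl
  · have h := (isAffineClass_zero_iff K _).mp hv i (by have := i.2; omega)
    rwa [seqOf_apply_of_lt K v i.2] at h

/-- **`P_N(0) = 0`**. -/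
theorem ncard_setOf_isPolarClass_zero (N : ℕ) : {v : Fin (N + 1) → K | IsPolarClass K N 0 (seqOf K v)}.ncard = 0 := by
  have he : {v : Fin (N + 1) → K | IsPolarClass K N 0 (seqOf K v)} = ∅ := Set.eq_empty_iff_forall_notMem.mpr fun v hv => not_isPolarClass_zero K _ hv
  rw [he, Set.ncard_empty]

/-! ## §547. The census -/
/-- the arithmetic of the polar recursion. -/
theorem census_arith_polar (s d : ℕ) (hs : 1 ≤ s) (hd : 1 ≤ d) :
    (s - 1) * ((s - 1) * s ^ (2 * d - 1)) + s * ((s - 1) * s ^ (2 * d - 2)) = (s - 1) * s ^ (2 * (d + 1) - 2) := by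
  obtain ⟨u, rfl⟩ := Nat.exists_eq_add_of_le' hs
  obtain ⟨c, rfl⟩ := Nat.exists_eq_add_of_le' hd
  rw [Nat.add_sub_cancel, show 2 * (c + 1) - 1 = 2 * c + 1 by omega, show 2 * (c + 1) - 2 = 2 * c by omega, show 2 * (c + 1 + 1) - 2 = 2 * c + 2 by omega]
  ring

/-- the arithmetic of the partition: `Σ_{r ≤ t} T(r) = s^{2t}`. -/
theorem census_arith_sum (s : ℕ) (hs : 1 ≤ s) (t : ℕ) :
    ∑ r ∈ Finset.range (t + 1), ((if r = 0 then 1 else (s - 1) * s ^ (2 * r - 1)) + (if r = 0 then 0 else (s - 1) * s ^ (2 * r - 2))) = s ^ (2 * t) := by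
  obtain ⟨u, rfl⟩ := Nat.exists_eq_add_of_le' hs
  induction t with
  | zero => simp
  | succ t ih =>
    rw [Finset.sum_range_succ, ih, if_neg (Nat.succ_ne_zero t), if_neg (Nat.succ_ne_zero t), Nat.add_sub_cancel,
      show 2 * (t + 1) - 1 = 2 * t + 1 by omega, show 2 * (t + 1) - 2 = 2 * t by omega, show 2 * (t + 1) = 2 * t + 2 by omega]
    ring

/-- **THE `F_s`-CENSUS BY MIDDLE RANK AND TYPE (induction on the level): over a finite field with `s` elements, for `2r ≤ N + 1` the classes on `[0, N]` of middle rank `r` number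
`A_N(r) = (s − 1)·s^{2r−1}` affine ones and `P_N(r) = (s − 1)·s^{2r−2}` polar ones for `r ≥ 1` (`A_N(0) = 1`, `P_N(0) = 0`) — independently of `N`.** -/
theorem ncard_setOf_isAffineClass_and_isPolarClass [Finite K] (N : ℕ) : ∀ r : ℕ, r + r ≤ N + 1 →
    {v : Fin (N + 1) → K | IsAffineClass K N r (seqOf K v)}.ncard = (if r = 0 then 1 else (Nat.card K - 1) * Nat.card K ^ (2 * r - 1))
      ∧ {v : Fin (N + 1) → K | IsPolarClass K N r (seqOf K v)}.ncard = (if r = 0 then 0 else (Nat.card K - 1) * Nat.card K ^ (2 * r - 2)) := by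
  have hs : 1 ≤ Nat.card K := (Finite.one_lt_card (α := K)).le
  induction N with
  | zero =>
    intro r hr; obtain rfl : r = 0 := by omega
    exact ⟨by rw [if_pos rfl]; exact ncard_setOf_isAffineClass_zero K 0, by rw [if_pos rfl]; exact ncard_setOf_isPolarClass_zero K 0⟩
  | succ N ih =>
    intro r hr
    rcases Nat.eq_zero_or_pos r with rfl | hpos
    · exact ⟨by rw [if_pos rfl]; exact ncard_setOf_isAffineClass_zero K (N + 1), by rw [if_pos rfl]; exact ncard_setOf_isPolarClass_zero K (N + 1)⟩
    obtain ⟨d, rfl⟩ : ∃ d, r = d + 1 := ⟨r - 1, by omega⟩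
    obtain ⟨ihA, ihP⟩ := ih d (by omega)
    refine ⟨?_, ?_⟩
    · -- affine classes
      rw [if_neg (Nat.succ_ne_zero d)]
      rcases Nat.lt_or_ge (N + 1) (d + 1 + (d + 1)) with hlt | hle
      · -- the top rank of the odd level `N + 1 = 2d + 1`: over the generic classes of the even level `N = 2d`
        obtain rfl : N = 2 * d := by omega
        have hG := sum_ncard_setOf_rank_half_eq K d
        rw [Finset.sum_range_succ, Finset.sum_congr rfl fun r hr => by
          rw [ncard_setOf_rank_half_eq_add, (ih r (by have := Finset.mem_range.mp hr; omega)).1, (ih r (by have := Finset.mem_range.mp hr; omega)).2],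
          census_arith_sum _ hs] at hG
        rw [ncard_setOf_isAffineClass_top_level_succ, show 2 * (d + 1) - 1 = 2 * d + 1 by omega]
        obtain ⟨u, hu⟩ := Nat.exists_eq_add_of_le' hs
        rw [hu] at hG ⊢; rw [Nat.add_sub_cancel]
        have e : {v : Fin (2 * d + 1) → K | (hankel1 K (2 * d) (2 * d / 2) (seqOf K v)).rank = d + 1}.ncard = u * (u + 1) ^ (2 * d) := by
          have : (u + 1) ^ (2 * d + 1) = (u + 1) ^ (2 * d) + u * (u + 1) ^ (2 * d) := by ring
          omega
        rw [e]; ring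
      · rw [ncard_setOf_isAffineClass_level_succ K hle, (ih (d + 1) hle).1, if_neg (Nat.succ_ne_zero d)]
    · -- polar classes
      rw [if_neg (Nat.succ_ne_zero d), ncard_setOf_isPolarClass_level_succ K (show d + d ≤ N by omega), ihA, ihP]
      rcases Nat.eq_zero_or_pos d with rfl | hdpos
      · simp
      · rw [if_neg (by omega), if_neg (by omega), census_arith_polar _ _ hs hdpos]

/-- **`A_N(r) = (s − 1)·s^{2r−1}` affine classes of rank `r ≥ 1`** (`2r ≤ N + 1`). -/
theorem ncard_setOf_isAffineClass [Finite K] {r : ℕ} (hr : 1 ≤ r) (h2 : r + r ≤ N + 1) :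
    {v : Fin (N + 1) → K | IsAffineClass K N r (seqOf K v)}.ncard = (Nat.card K - 1) * Nat.card K ^ (2 * r - 1) := by
  rw [(ncard_setOf_isAffineClass_and_isPolarClass K N r h2).1, if_neg (by omega)]

/-- **`P_N(r) = (s − 1)·s^{2r−2}` polar classes of rank `r ≥ 1`** (`2r ≤ N + 1`). -/
theorem ncard_setOf_isPolarClass [Finite K] {r : ℕ} (hr : 1 ≤ r) (h2 : r + r ≤ N + 1) :
    {v : Fin (N + 1) → K | IsPolarClass K N r (seqOf K v)}.ncard = (Nat.card K - 1) * Nat.card K ^ (2 * r - 2) := by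
  rw [(ncard_setOf_isAffineClass_and_isPolarClass K N r h2).2, if_neg (by omega)]

/-- **THE CENSUS BY MIDDLE RANK: `#{v on [0, N] | R^N(v) = r} = (s² − 1)·s^{2r−2}` for `1 ≤ r`, `2r ≤ N + 1`** — independent of `N`. -/
theorem ncard_setOf_rank_half_eq [Finite K] {r : ℕ} (hr : 1 ≤ r) (h2 : r + r ≤ N + 1) :
    {v : Fin (N + 1) → K | (hankel1 K N (N / 2) (seqOf K v)).rank = r}.ncard = (Nat.card K ^ 2 - 1) * Nat.card K ^ (2 * r - 2) := by
  rw [ncard_setOf_rank_half_eq_add, ncard_setOf_isAffineClass K hr h2, ncard_setOf_isPolarClass K hr h2]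
  obtain ⟨u, hu⟩ := Nat.exists_eq_add_of_le' (Finite.one_lt_card (α := K)).le
  obtain ⟨c, rfl⟩ := Nat.exists_eq_add_of_le' hr
  rw [hu, Nat.add_sub_cancel, show 2 * (c + 1) - 1 = 2 * c + 1 by omega, show 2 * (c + 1) - 2 = 2 * c by omega,
    show (u + 1) ^ 2 - 1 = u * u + 2 * u by rw [show (u + 1) ^ 2 = u * u + 2 * u + 1 by ring, Nat.add_sub_cancel]]
  ring

/-- **one class of rank `0`.** -/
theorem ncard_setOf_rank_half_eq_zero [Finite K] (N : ℕ) : {v : Fin (N + 1) → K | (hankel1 K N (N / 2) (seqOf K v)).rank = 0}.ncard = 1 := by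
  rw [ncard_setOf_rank_half_eq_add, ncard_setOf_isAffineClass_zero, ncard_setOf_isPolarClass_zero]

/-- **THE CUMULATIVE CENSUS: `#{v on [0, N] | R^N(v) ≤ r} = s^{2r}` for `2r ≤ N + 1`** (telescoping the exact counts). -/
theorem ncard_setOf_rank_half_le [Finite K] {r : ℕ} (h2 : r + r ≤ N + 1) :
    {v : Fin (N + 1) → K | (hankel1 K N (N / 2) (seqOf K v)).rank ≤ r}.ncard = Nat.card K ^ (2 * r) := by
  classical
  haveI := Fintype.ofFinite K
  have hmaps : ((Finset.univ.filter fun v : Fin (N + 1) → K => (hankel1 K N (N / 2) (seqOf K v)).rank ≤ r : Finset (Fin (N + 1) → K)) : Set (Fin (N + 1) → K)).MapsTo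
      (fun v => (hankel1 K N (N / 2) (seqOf K v)).rank) (Finset.range (r + 1) : Finset ℕ) := fun v hv =>
    Finset.mem_coe.mpr (Finset.mem_range.mpr (Nat.lt_succ_of_le (Finset.mem_filter.mp (Finset.mem_coe.mp hv)).2))
  rw [ncard_setOf_eq_card_filter, Finset.card_eq_sum_card_fiberwise hmaps, ← census_arith_sum _ (Finite.one_lt_card (α := K)).le r]
  refine Finset.sum_congr rfl fun r' hr' => ?_
  have hr'2 : r' + r' ≤ N + 1 := by have := Finset.mem_range.mp hr'; omega
  rw [Finset.filter_filter, ← (ncard_setOf_isAffineClass_and_isPolarClass K N r' hr'2).1, ← (ncard_setOf_isAffineClass_and_isPolarClass K N r' hr'2).2,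
    ← ncard_setOf_rank_half_eq_add, ncard_setOf_eq_card_filter]
  congr 1
  exact Finset.filter_congr fun v _ => ⟨fun h => h.2, fun h => ⟨by have := Finset.mem_range.mp hr'; omega, h⟩⟩

/-- **THE GENERIC CLASSES OF AN EVEN LEVEL: `#{v on [0, 2t] | R^{2t}(v) = t + 1} = (s − 1)·s^{2t}`.** -/
theorem ncard_setOf_rank_half_eq_top [Finite K] (t : ℕ) :
    {v : Fin (2 * t + 1) → K | (hankel1 K (2 * t) (2 * t / 2) (seqOf K v)).rank = t + 1}.ncard = (Nat.card K - 1) * Nat.card K ^ (2 * t) := by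
  have hs : 1 ≤ Nat.card K := (Finite.one_lt_card (α := K)).le
  have hG := sum_ncard_setOf_rank_half_eq K t
  rw [Finset.sum_range_succ, Finset.sum_congr rfl fun r hr => by
    rw [ncard_setOf_rank_half_eq_add, (ncard_setOf_isAffineClass_and_isPolarClass K (2 * t) r (by have := Finset.mem_range.mp hr; omega)).1,
      (ncard_setOf_isAffineClass_and_isPolarClass K (2 * t) r (by have := Finset.mem_range.mp hr; omega)).2], census_arith_sum _ hs] at hG
  obtain ⟨u, hu⟩ := Nat.exists_eq_add_of_le' hs
  rw [hu] at hG ⊢; rw [Nat.add_sub_cancel]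
  have : (u + 1) ^ (2 * t + 1) = (u + 1) ^ (2 * t) + u * (u + 1) ^ (2 * t) := by ring
  omega

/-! ## §548. Every shape: the `(k+1) × (N+1−k)` Hankel matrices by rank (trapezoid law N15) -/

/-- **HANKEL MATRICES OF EVERY SHAPE BY RANK: for `k ≤ N`, `h = min(k + 1, N + 1 − k)` the smaller side of `H^N_k` and `1 ≤ r < h`, exactly `(s² − 1)·s^{2r−2}` of the `s^{N+1}`
matrices `H^N_k(v)` have rank `r`** (by N15 `rank H^N_k = min(h, R^N)`, and `r < h` forces `R^N = r`). -/
theorem ncard_setOf_rank_hankel1_eq [Finite K] {k r : ℕ} (hk : k ≤ N) (hr : 1 ≤ r) (hrh : r < min (k + 1) (N + 1 - k)) :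
    {v : Fin (N + 1) → K | (hankel1 K N k (seqOf K v)).rank = r}.ncard = (Nat.card K ^ 2 - 1) * Nat.card K ^ (2 * r - 2) := by
  rw [← ncard_setOf_rank_half_eq K (N := N) hr (by have := min_le_left (k + 1) (N + 1 - k); have := min_le_right (k + 1) (N + 1 - k); omega)]
  congr 1
  ext v
  rw [Set.mem_setOf_eq, Set.mem_setOf_eq, rank_hankel1_eq_min K hk]
  constructor
  · intro h
    rcases le_total (min (k + 1) (N + 1 - k)) ((hankel1 K N (N / 2) (seqOf K v)).rank) with hle | hle
    · rw [min_eq_left hle] at h; omega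
    · rwa [min_eq_right hle] at h
  · intro h; rw [h]; exact min_eq_right hrh.le

/-- **… and `s^{N+1} − s^{2h−2}` have full rank `h = min(k + 1, N + 1 − k)`** (the complement of `R^N ≤ h − 1`, counted by the cumulative census). -/
theorem ncard_setOf_rank_hankel1_eq_height [Finite K] {k : ℕ} (hk : k ≤ N) :
    {v : Fin (N + 1) → K | (hankel1 K N k (seqOf K v)).rank = min (k + 1) (N + 1 - k)}.ncard = Nat.card K ^ (N + 1) - Nat.card K ^ (2 * (min (k + 1) (N + 1 - k) - 1)) := by
  classical
  haveI := Fintype.ofFinite K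
  set h := min (k + 1) (N + 1 - k) with hh
  have h1 : 1 ≤ h := by rw [hh, le_min_iff]; omega
  have hhN : (h - 1) + (h - 1) ≤ N + 1 := by have := min_le_left (k + 1) (N + 1 - k); have := min_le_right (k + 1) (N + 1 - k); omega
  have key : {v : Fin (N + 1) → K | (hankel1 K N k (seqOf K v)).rank = h} = {v : Fin (N + 1) → K | (hankel1 K N (N / 2) (seqOf K v)).rank ≤ h - 1}ᶜ := by
    ext v
    rw [Set.mem_compl_iff, Set.mem_setOf_eq, Set.mem_setOf_eq, rank_hankel1_eq_min K hk, ← hh, not_le]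
    constructor
    · intro e
      by_contra hlt
      rw [min_eq_right (by omega : (hankel1 K N (N / 2) (seqOf K v)).rank ≤ h)] at e
      omega
    · intro hlt; exact min_eq_left (by omega)
  rw [key, Set.ncard_compl _ (Set.toFinite _), ncard_setOf_rank_half_le K hhN, Nat.card_fun, Nat.card_eq_fintype_card (α := Fin (N + 1)), Fintype.card_fin]

end Summit.Ventures.HSemireg.Wedge.HankelOuter
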